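import Summits.Ventures.WeilGRH.TwistedGramCellCheckC
import HarnessLib

/-!
# GRH arm: twisted format C — far-row tables of a χ-cell and the midpoint/radius Schur box (checker `K`, part 1)

RE-LAND NOTE (weil-grh-2 gen16, 2026-08-25): docstring-only re-submission of p389540 to re-trigger the hub olean build that batch time-outs kept dropping
(digest build events «killed: timeout», attempts ≥ 9); every declaration below is byte-identical to the accepted p389540.

Cell `rh-explicit`, WEIL TRACK — GRH ARM (engine seat weil-grh-2 gen15).  Part 1 of the cell checker `K` (part 2:
`TwistedGramCellCheckCK`; the big-integer dot product: `TwistedGramKroneckerDot`).  The far rows `[M(i, 2B−1+c)]_c` of the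
entry boxes (`entryC` of `TwistedGramCellCheckC`) and their weighted copies `[M·2^{wbits}/wN[c/2]]_c` are tabulated once
(`farRowK`, `scaleRowK`, `farTabK`); a row of boxes is reduced to its doubled midpoints `lo+hi` (`rowM`), `Σ|lo+hi|` (`rowSAbs`) and
`max (hi−lo)` (`rowWMax`).  ★ `mem_schurBoxK`: if `X_c ∋ f c`, `Y_c ∋ g c` (proper boxes, `c < n`) and `P = Σ_c (lo+hi)(lo'+hi')`
(`dotZK`), then `Σ_c f c·g c ∈ [(P−E)/(4S), (P+E)/(4S)]` with the crude radius `E = W_Y Σ|X| + W_X Σ|Y| + n W_X W_Y` — so the Schur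
column sum of a pair costs ONE integer dot product (supplied by the caller; part 2 takes it from the Kronecker product).
Everything proved; computable `def`s; RH/GRH-free.  References: H. Yoshida (1992) §7 [Yoshida1992HermitianForms];
R. E. Moore (1966) Ch. 3 [Moore1966].
-/

set_option autoImplicit false
set_option linter.style.longLine false

open Real Complex Finset
open scoped BigOperators ArithmeticFunction.vonMangoldt ComplexConjugate

namespace Summit.Ventures.WeilGRH

open Literature.NumberTheory.LFunctions Literature.NumberTheory.LFunctions.Yoshida1992
open Literature.NumberTheory.LFunctions.Yoshida1992.Encl
open Literature.Analysis.SpecialFunctions Literature.Analysis.ValidatedNumerics.NumericsMP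
open Literature.Analysis.ValidatedNumerics (Numerics.cdiv Numerics.fdiv_mul_le_real Numerics.le_cdiv_mul_real)

namespace TwistedEncl

/-! ## Far rows and their reductions -/

/-- Far row of entry boxes `[M(i, 2B−1+c)]`, `c = c₀, …, c₀+n−1`. [cite: Yoshida1992HermitianForms, §7 pp. 305–312] -/
def farRowK (S : ℕ) (C : Consts) (xs ys : List MI) (LQ : MI) (tab : List IdxRec) (B i : ℕ) : ℕ → ℕ → List MI
  | _, 0 => []
  | c0, n + 1 => entryC S C xs ys LQ tab i (2 * B - 1 + c0) :: farRowK S C xs ys LQ tab B i (c0 + 1) n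

/-- Weighted copy of a far row: `M ↦ M·2^{wbits}/wN[c/2]` (running column counter `c`). [folklore] -/
def scaleRowK (wbits : ℕ) (wN : List ℕ) : List MI → ℕ → List MI
  | [], _ => []
  | y :: ys, c => ((y.mulInt ((2 : ℤ) ^ wbits)).divNat (wN.getD (c / 2) 0)) :: scaleRowK wbits wN ys (c + 1)

/-- Doubled midpoints `lo + hi`. [folklore] -/
def rowM : List MI → List ℤ
  | [] => []
  | b :: r => (b.lo + b.hi) :: rowM r

/-- `Σ |lo + hi|`. [folklore] -/
def rowSAbs : List MI → ℕ
  | [] => 0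
  | b :: r => (b.lo + b.hi).natAbs + rowSAbs r

/-- `max (hi − lo)`. [folklore] -/
def rowWMax : List MI → ℕ
  | [] => 0
  | b :: r => max (b.hi - b.lo).toNat (rowWMax r)

/-- All boxes proper (`lo ≤ hi`). [folklore] -/
def rowProper : List MI → Bool
  | [] => true
  | b :: r => decide (b.lo ≤ b.hi) && rowProper r

/-- Truncating dot product on `ℤ` (structural; the caller identifies it with its own evaluation). [folklore] -/
def dotZK : List ℤ → List ℤ → ℤ
  | a :: as, b :: bs => a * b + dotZK as bs
  | _, _ => 0

/-- ★ The Schur box of a pair from the integer dot product `P` of the doubled midpoints and the row statistics: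
`[(P−E)/(4S), (P+E)/(4S)]` outward, `E = W_Y Σ|X| + W_X Σ|Y| + n W_X W_Y`. [cite: Moore1966, Ch. 3 (interval arithmetic: inclusion property)] -/
def schurBoxK (S n : ℕ) (P : ℤ) (sX wX sY wY : ℕ) : MI :=
  let E : ℕ := wY * sX + wX * sY + n * (wX * wY)
  ⟨(P - E) / ((4 * S : ℕ) : ℤ), Numerics.cdiv (P + E) ((4 * S : ℕ) : ℤ)⟩

/-- The table of far rows `i = i₀, …, i₀+k−1`. [folklore] -/
def farTabK (S : ℕ) (C : Consts) (xs ys : List MI) (LQ : MI) (tab : List IdxRec) (d : CCellData) : ℕ → ℕ → List (List MI)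
  | _, 0 => []
  | i0, k + 1 => farRowK S C xs ys LQ tab d.B i0 0 (2 * (d.B3 - d.B)) :: farTabK S C xs ys LQ tab d (i0 + 1) k

/-! ## Bookkeeping -/

variable {S : ℕ}

/-- Length of a far row. [folklore] -/
theorem length_farRowK (S : ℕ) (C : Consts) (xs ys : List MI) (LQ : MI) (tab : List IdxRec) (B i : ℕ) :
    ∀ c0 n, (farRowK S C xs ys LQ tab B i c0 n).length = n
  | _, 0 => rfl
  | c0, n + 1 => by simp [farRowK, length_farRowK S C xs ys LQ tab B i (c0 + 1) n]

/-- Entries of a far row. [folklore] -/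
theorem getD_farRowK (S : ℕ) (C : Consts) (xs ys : List MI) (LQ : MI) (tab : List IdxRec) (B i : ℕ) :
    ∀ c0 n c, c < n → (farRowK S C xs ys LQ tab B i c0 n).getD c default = entryC S C xs ys LQ tab i (2 * B - 1 + (c0 + c))
  | _, 0, _, h => absurd h (Nat.not_lt_zero _)
  | c0, n + 1, 0, _ => by simp [farRowK]
  | c0, n + 1, c + 1, h => by
      simp only [farRowK, List.getD_cons_succ]
      rw [getD_farRowK S C xs ys LQ tab B i (c0 + 1) n c (by omega), show c0 + 1 + c = c0 + (c + 1) by omega]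

/-- Length of a weighted row. [folklore] -/
theorem length_scaleRowK (wbits : ℕ) (wN : List ℕ) : ∀ (ys : List MI) (c : ℕ), (scaleRowK wbits wN ys c).length = ys.length
  | [], _ => rfl
  | y :: ys, c => by simp [scaleRowK, length_scaleRowK wbits wN ys (c + 1)]

/-- Entries of a weighted row. [folklore] -/
theorem getD_scaleRowK (wbits : ℕ) (wN : List ℕ) : ∀ (ys : List MI) (c0 c : ℕ), c < ys.length →
    (scaleRowK wbits wN ys c0).getD c default = ((ys.getD c default).mulInt ((2 : ℤ) ^ wbits)).divNat (wN.getD ((c0 + c) / 2) 0)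
  | [], _, _, h => absurd h (Nat.not_lt_zero _)
  | y :: ys, c0, 0, _ => by simp [scaleRowK]
  | y :: ys, c0, c + 1, h => by
      simp only [scaleRowK, List.getD_cons_succ]
      rw [getD_scaleRowK wbits wN ys (c0 + 1) c (by simpa using h), show c0 + 1 + c = c0 + (c + 1) by omega]

/-- Number of rows of the table. [folklore] -/
theorem length_farTabK (S : ℕ) (C : Consts) (xs ys : List MI) (LQ : MI) (tab : List IdxRec) (d : CCellData) :
    ∀ i0 k, (farTabK S C xs ys LQ tab d i0 k).length = k
  | _, 0 => rfl
  | i0, k + 1 => by simp [farTabK, length_farTabK S C xs ys LQ tab d (i0 + 1) k]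

/-- Rows of the table. [folklore] -/
theorem getD_farTabK (S : ℕ) (C : Consts) (xs ys : List MI) (LQ : MI) (tab : List IdxRec) (d : CCellData) :
    ∀ i0 k i, i < k → (farTabK S C xs ys LQ tab d i0 k).getD i [] = farRowK S C xs ys LQ tab d.B (i0 + i) 0 (2 * (d.B3 - d.B))
  | _, 0, _, h => absurd h (Nat.not_lt_zero _)
  | i0, k + 1, 0, _ => by simp [farTabK]
  | i0, k + 1, i + 1, h => by
      simp only [farTabK, List.getD_cons_succ]
      rw [getD_farTabK S C xs ys LQ tab d (i0 + 1) k i (by omega), show i0 + 1 + i = i0 + (i + 1) by omega]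

/-- Length of the doubled midpoints. [folklore] -/
theorem length_rowM : ∀ X : List MI, (rowM X).length = X.length
  | [] => rfl
  | _ :: X => by simp [rowM, length_rowM X]

/-- What `rowProper` certifies. [folklore] -/
theorem rowProper_spec : ∀ {X : List MI}, rowProper X = true → ∀ b ∈ X, b.lo ≤ b.hi
  | [], _, b, hb => by simp at hb
  | c :: X, h, b, hb => by
      simp only [rowProper, Bool.and_eq_true, decide_eq_true_eq] at h
      rcases List.mem_cons.mp hb with rfl | hb'
      · exact h.1
      · exact rowProper_spec h.2 b hb'

/-! ## The Schur box is sound -/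

/-- One term: `|4S²uv − (l+h)(l'+h')| ≤ |l+h|·w' + w·|l'+h'| + w·w'` (`w = h−l`, `w' = h'−l'`). [cite: Moore1966, Ch. 3 (interval arithmetic: inclusion property)] -/
theorem abs_term_le {u v : ℝ} {I J : MI} (hu : MI.mem S u I) (hv : MI.mem S v J) :
    |4 * (S : ℝ) ^ 2 * (u * v) - ((I.lo + I.hi : ℤ) : ℝ) * ((J.lo + J.hi : ℤ) : ℝ)| ≤
      |((I.lo + I.hi : ℤ) : ℝ)| * ((J.hi - J.lo : ℤ) : ℝ) + ((I.hi - I.lo : ℤ) : ℝ) * |((J.lo + J.hi : ℤ) : ℝ)|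
        + ((I.hi - I.lo : ℤ) : ℝ) * ((J.hi - J.lo : ℤ) : ℝ) := by
  obtain ⟨hu1, hu2⟩ := hu
  obtain ⟨hv1, hv2⟩ := hv
  set A : ℝ := ((I.lo + I.hi : ℤ) : ℝ)
  set A' : ℝ := ((J.lo + J.hi : ℤ) : ℝ)
  set δ : ℝ := 2 * (u * S) - A
  set δ' : ℝ := 2 * (v * S) - A'
  have hδ : |δ| ≤ ((I.hi - I.lo : ℤ) : ℝ) := by
    rw [abs_le]; constructor <;> · simp only [δ, A]; push_cast; linarith
  have hδ' : |δ'| ≤ ((J.hi - J.lo : ℤ) : ℝ) := by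
    rw [abs_le]; constructor <;> · simp only [δ', A']; push_cast; linarith
  have e : 4 * (S : ℝ) ^ 2 * (u * v) - A * A' = A * δ' + δ * A' + δ * δ' := by
    simp only [δ, δ']; ring
  rw [e]
  calc |A * δ' + δ * A' + δ * δ'| ≤ |A * δ'| + |δ * A'| + |δ * δ'| := by
        have := abs_add_le (A * δ' + δ * A') (δ * δ'); have := abs_add_le (A * δ') (δ * A'); linarith
    _ = |A| * |δ'| + |δ| * |A'| + |δ| * |δ'| := by rw [abs_mul, abs_mul, abs_mul]
    _ ≤ |A| * ((J.hi - J.lo : ℤ) : ℝ) + ((I.hi - I.lo : ℤ) : ℝ) * |A'| + ((I.hi - I.lo : ℤ) : ℝ) * ((J.hi - J.lo : ℤ) : ℝ) := by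
        gcongr
        · exact (abs_nonneg δ).trans hδ

/-- `((n : ℕ) : ℝ)` of `natAbs` and `toNat`. [folklore] -/
theorem cast_natAbs_eq (z : ℤ) : ((z.natAbs : ℕ) : ℝ) = |((z : ℤ) : ℝ)| := by
  rw [← Int.cast_natCast, Int.natCast_natAbs, Int.cast_abs]

/-- ★ `|4S²·Σ_{c<n} f g − dotZ| ≤ W_Y Σ|X| + W_X Σ|Y| + n W_X W_Y` for proper boxes `X_c ∋ f c`, `Y_c ∋ g c` and width bounds
`W_X ≥ max width X`, `W_Y ≥ max width Y`. [cite: Moore1966, Ch. 3 (interval arithmetic: inclusion property)] -/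
theorem abs_sub_dotZ_le : ∀ (X Y : List MI) (f g : ℕ → ℝ), X.length = Y.length →
    rowProper X = true → rowProper Y = true →
    (∀ c < X.length, MI.mem S (f c) (X.getD c default)) → (∀ c < X.length, MI.mem S (g c) (Y.getD c default)) →
    ∀ WX WY : ℕ, rowWMax X ≤ WX → rowWMax Y ≤ WY →
    |4 * (S : ℝ) ^ 2 * (∑ c ∈ Finset.range X.length, f c * g c) - ((dotZK (rowM X) (rowM Y) : ℤ) : ℝ)| ≤
      (WY : ℝ) * (rowSAbs X : ℕ) + (WX : ℝ) * (rowSAbs Y : ℕ) + (X.length : ℝ) * ((WX : ℝ) * WY)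
  | [], [], _, _, _, _, _, _, _, _, _, _, _ => by simp [dotZK, rowM, rowSAbs]
  | [], _ :: _, _, _, h, _, _, _, _, _, _, _, _ => by simp at h
  | _ :: _, [], _, _, h, _, _, _, _, _, _, _, _ => by simp at h
  | I :: X, J :: Y, f, g, hl, hX, hY, hf, hg, WX, WY, hWX, hWY => by
      have hl' : X.length = Y.length := by simpa using hl
      simp only [rowProper, Bool.and_eq_true, decide_eq_true_eq] at hX hY
      simp only [rowWMax, max_le_iff] at hWX hWY
      have hI : ((I.hi - I.lo : ℤ) : ℝ) ≤ WX := by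
        have h1 : ((I.hi - I.lo).toNat : ℤ) = I.hi - I.lo := Int.toNat_of_nonneg (by linarith [hX.1])
        have h2 : ((I.hi - I.lo).toNat : ℝ) ≤ WX := by exact_mod_cast hWX.1
        rw [← h1]; exact_mod_cast h2
      have hJ : ((J.hi - J.lo : ℤ) : ℝ) ≤ WY := by
        have h1 : ((J.hi - J.lo).toNat : ℤ) = J.hi - J.lo := Int.toNat_of_nonneg (by linarith [hY.1])
        have h2 : ((J.hi - J.lo).toNat : ℝ) ≤ WY := by exact_mod_cast hWY.1
        rw [← h1]; exact_mod_cast h2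
      have hI0 : (0 : ℝ) ≤ ((I.hi - I.lo : ℤ) : ℝ) := by exact_mod_cast (sub_nonneg.mpr hX.1)
      have ih := abs_sub_dotZ_le X Y (fun c ↦ f (c + 1)) (fun c ↦ g (c + 1)) hl' hX.2 hY.2
        (fun c hc ↦ by simpa using hf (c + 1) (by simpa using hc)) (fun c hc ↦ by simpa using hg (c + 1) (by simpa using hc))
        WX WY hWX.2 hWY.2
      have h0 := abs_term_le (hf 0 (by simp)) (hg 0 (by simp))
      simp only [List.getD_cons_zero] at h0
      rw [List.length_cons, Finset.sum_range_succ']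
      simp only [rowM, dotZK, rowSAbs, Nat.cast_add, Nat.cast_one, cast_natAbs_eq]
      push_cast at h0 ih hI hJ hI0 ⊢
      have hJ0 : (0 : ℝ) ≤ (J.hi : ℝ) - J.lo := by
        have : (0 : ℝ) ≤ ((J.hi - J.lo : ℤ) : ℝ) := by exact_mod_cast (sub_nonneg.mpr hY.1)
        push_cast at this; exact this
      have e : 4 * (S : ℝ) ^ 2 * (∑ c ∈ Finset.range X.length, f (c + 1) * g (c + 1) + f 0 * g 0)
          - (((I.lo : ℝ) + I.hi) * ((J.lo : ℝ) + J.hi) + ((dotZK (rowM X) (rowM Y) : ℤ) : ℝ)) =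
          (4 * (S : ℝ) ^ 2 * (f 0 * g 0) - ((I.lo : ℝ) + I.hi) * ((J.lo : ℝ) + J.hi))
            + (4 * (S : ℝ) ^ 2 * (∑ c ∈ Finset.range X.length, f (c + 1) * g (c + 1)) - ((dotZK (rowM X) (rowM Y) : ℤ) : ℝ)) := by
        ring
      rw [e]
      refine (abs_add_le _ _).trans ?_
      have hA0 : (0 : ℝ) ≤ |(I.lo : ℝ) + I.hi| := abs_nonneg _
      have hB0 : (0 : ℝ) ≤ |(J.lo : ℝ) + J.hi| := abs_nonneg _
      have hWX0 : (0 : ℝ) ≤ WX := Nat.cast_nonneg _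
      have hWY0 : (0 : ℝ) ≤ WY := Nat.cast_nonneg _
      have h0' : |4 * (S : ℝ) ^ 2 * (f 0 * g 0) - ((I.lo : ℝ) + I.hi) * ((J.lo : ℝ) + J.hi)| ≤
          |(I.lo : ℝ) + I.hi| * WY + WX * |(J.lo : ℝ) + J.hi| + WX * WY := by
        refine h0.trans ?_
        gcongr
      nlinarith [h0', ih, hA0, hB0]

/-- ★★ **The Schur box is sound**: proper boxes `X_c ∋ f c`, `Y_c ∋ g c` (`c < n`) and `P = dotZK (rowM X) (rowM Y)` ⇒
`Σ_{c<n} f c · g c ∈ schurBoxK S n P (Σ|X|) (W_X) (Σ|Y|) (W_Y)`. [cite: Moore1966, Ch. 3 (interval arithmetic: inclusion property)] -/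
theorem mem_schurBoxK (hS : 0 < S) {X Y : List MI} {f g : ℕ → ℝ} {n : ℕ} (hXl : X.length = n) (hYl : Y.length = n)
    (hXp : rowProper X = true) (hYp : rowProper Y = true)
    (hf : ∀ c < n, MI.mem S (f c) (X.getD c default)) (hg : ∀ c < n, MI.mem S (g c) (Y.getD c default))
    {P : ℤ} (hP : P = dotZK (rowM X) (rowM Y)) :
    MI.mem S (∑ c ∈ Finset.range n, f c * g c) (schurBoxK S n P (rowSAbs X) (rowWMax X) (rowSAbs Y) (rowWMax Y)) := by
  have hE := abs_sub_dotZ_le X Y f g (by rw [hXl, hYl]) hXp hYp (by rw [hXl]; exact hf) (by rw [hXl]; exact hg)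
    (rowWMax X) (rowWMax Y) le_rfl le_rfl
  rw [hXl, ← hP] at hE
  obtain ⟨hE1, hE2⟩ := abs_le.mp hE
  set s := ∑ c ∈ Finset.range n, f c * g c
  set E : ℕ := rowWMax Y * rowSAbs X + rowWMax X * rowSAbs Y + n * (rowWMax X * rowWMax Y) with hEdef
  have hEr : (E : ℝ) = (rowWMax Y : ℝ) * (rowSAbs X : ℕ) + (rowWMax X : ℝ) * (rowSAbs Y : ℕ) + (n : ℝ) * ((rowWMax X : ℝ) * rowWMax Y) := by
    simp [hEdef]
  have h4S : (0 : ℤ) < ((4 * S : ℕ) : ℤ) := by exact_mod_cast Nat.mul_pos (by norm_num) hS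
  have hSr : (0 : ℝ) < S := by exact_mod_cast hS
  unfold schurBoxK
  constructor
  · have h := Numerics.fdiv_mul_le_real (a := P - E) h4S
    have h' : (((P - E) / ((4 * S : ℕ) : ℤ) : ℤ) : ℝ) * (4 * S) ≤ (P : ℝ) - E := by push_cast at h ⊢; exact h
    nlinarith [h', hE1, hE2, hEr, hSr]
  · have h := Numerics.le_cdiv_mul_real (a := P + E) h4S
    have h' : (P : ℝ) + E ≤ ((Numerics.cdiv (P + E) ((4 * S : ℕ) : ℤ) : ℤ) : ℝ) * (4 * S) := by push_cast at h ⊢; exact h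
    nlinarith [h', hE1, hE2, hEr, hSr]

end TwistedEncl

end Summit.Ventures.WeilGRH
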